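import Summits.QuantumFields.YangMills.Theses.SoftLoopLongLag
import Summits.QuantumFields.YangMills.Theorems.SoftLoopLongLagDefs
import Summits.QuantumFields.YangMills.Theorems.SoftLoopLongLagSoftLoopLagFloorToTorusStubLimitPassageG
import Summits.QuantumFields.YangMills.Theorems.ColdBoxAllGroupsDefs
import Summits.QuantumFields.YangMills.Theorems.SoftLoopLongLagCondMeanInnerMixtureG
import HarnessLib
import HarnessLib.Audit

/-!
# Skeleton v6 (lead `ym-line-sll-p1`; E-ARCHITECTURE, shared inner stub E2 with T′ v7; P_K LANDED by ym-line-sll-p3: `condMeanSmooth_of_innerMixture`) — crux K′ `SoftLoopLagFloorToTorus` (stmt-QuantumFields-22504)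
# of route `SoftLoopLongLag` — `Cruxes/SoftLoopLagFloorToTorus/Lines/birth.lean`

HONEST LABEL.  Rung R2xi-G (leaf `WeakCouplingRates.XiPow`, an UPPER bound on the lattice mass gap, all compact simple `G`) —
RECORD label, NOT the Clay mass gap; no summit statement is touched.

THE CRUX (K′) = `T′ → X`, X: for every compact simple `G`, `r` there are `ε, q > 0`, `β₀` with: for `β ≥ β₀` and every
torus-limit state `μ` at coupling `β`, `β^{-q} ≤ rpCorr μ F ⌈β^ε⌉` and `rpCorr μ F 0 ≤ β^q` (`F` = cube-smeared time-zero soft loops, side `R = ⌈β^ε⌉`).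

THE LINE v6 (history: v0–v3 found the two interface defects of T′ — opaque `q`, box `4ε`; then the idle «γ cold ≥ 1/2» antecedent — both re-typed by
the planner at the lead's request, rev 3 = stmt-QuantumFields-24180; K1 → K1⁺ → K1⁺⁺ landed by ym-line-sll-p3; K3/K4 eliminated; K5 landed by the lead):
* **hT** = T′ rev 3 (USED): explicit floor `c·R³β^{-2}` for the conditioned kernel of `lagBox ⌈β^{8ε}⌉`, every `ε ≤ ε₀`, some `κ ≤ ε`, antecedent
  crude-good at scale `κ/2` ∧ exponential cold-typicality.
* **E2 `stub_innerDatumMeanSmoothG`** (SHARED with T′ v6, same name + signature; general `G`): inner-box (`[0,2H]⁴`, `H = ⌈β^a⌉`, sibling geometry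
  `boxKernelG`/`CrudeGoodG`) mean smoothness `|E_ζ F_sh∘α_R − E_ζ F_sh| ≤ K·R⁸·β^{κ−1}/H` for crude-good cold-typical inner data `ζ`.
* **P_K — LANDED** (ym-line-sll-p3, `Theorems/SoftLoopLongLagCondMeanInnerMixtureG.lean`, `condMeanSmooth_of_innerMixture`, used BY NAME): E2 at `H = ⌈β^{31ε/4}⌉` ⇒ OUTER
  conditional-mean smoothness `|m^ν_{F∘α_R}(η) − m^ν_F(η)| ≤ (2|K|+1)·R⁸·β^{κ−1}/H` for every outer datum `η` satisfying T′'s antecedent (conditioning removal, DLR consistency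
  `γ_Λ(·|η) = ∫ γ_inner(·|ζ) γ_Λ(dζ|η)` + translation, inner data crude-good on the outer cold event and cold-typical off a Markov-small set).
* **K1r `stub_dlrTransferG_of_goodFloor_of_smoothRate`** (ym-line-sll-p3: the landed K1⁺⁺ `dlrTransferG_of_goodFloor_of_smooth` with the mean-smoothness
  RATE abstracted to any `ρ(β)` with `ρ² = o(R³β^{-2})` and its antecedent in the exponential-typicality form): box floor ∧ smoothness ⇒ eventually
  `(c/8)·R³β^{-2} ≤ torusLagCov`.
* **K5 `stub_limitPassageG`** — CLOSED (lead, p585234).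
* Composition `torusFloor_lineForm` (kernel-checked): `ε := min (min ε₀ κ₂) (4a₂/31)`, `κ` from hT (`κ ≤ ε ≤ κ₂`), inner exponent `31ε/4` (so that
  `ρ² ≍ R¹⁶β^{2κ−2}/H² ≤ 2¹⁵K²·β^{5ε/2−2}… = o(R³β^{-2})` for EVERY `κ ≤ ε` — the reason the inner exponent sits strictly between `15ε/2` and `8ε`),
  `q := 3 + 8ε`.
WHY v5: the former K2 `stub_meanSmoothG` (outer `lagBox` geometry, conditioned kernel, rate `K·R⁸β^{2δ−1}/n`) would have needed the one-scale expansion on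
the `lagBox` geometry; E2 lives on the sibling engine's geometry and is the SAME stub T′ v6 needs — one analytic lemma serves both cruxes, the rest is plumbing.

OBJECTS: `softLoopObs`, `lagBox`, `coldEvent`, `coldKernel`, `lagCov`, `condMean`, `torusLagCov` = tree `Theorems/SoftLoopLongLagDefs.lean`;
`boxKernelG`, `CrudeGoodG` = `Theorems/ColdBoxAllGroupsDefs.lean`; `boxCentre` = `WeakCouplingRates`; `configShift` = `LatticeGaugeDLR`.  Stub files import
those modules (never this file / the Theses file) and prove the stub BY NAME + SIGNATURE.
-/

set_option autoImplicit false

noncomputable section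

namespace Summit.QuantumFields.YangMills.Cruxes.SoftLoopLagFloorToTorus.Birth

open MeasureTheory Filter Topology
open Literature.Probability.LatticeModels (Site box)
open Literature.MathematicalPhysics Literature.MathematicalPhysics.QuantumFieldTheory
open Literature.MathematicalPhysics.QuantumLattice
open Summit.QuantumFields.YangMills.Theorems.WeakCouplingRates
open Summit.QuantumFields.YangMills.Theorems.ColdBoxAllGroups (boxKernelG CrudeGoodG)
open Summit.QuantumFields.YangMills.Theorems.SoftLoopLongLag

/-! ## The stubs -/

/-- **E2 `stub_innerDatumMeanSmoothG`** (SHARED with T′ v6; general `G`): for inner data `ζ` crude-good at scale `κ/2` whose kernel is cold-typical,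
the kernel means of `F_sh` and `F_sh∘α_R` differ by at most `K·R⁸·β^{κ−1}/H`. -/
theorem stub_innerDatumMeanSmoothG :
    ∀ (G : Type) [Group G] [TopologicalSpace G] [IsTopologicalGroup G] [CompactSpace G] [MeasurableSpace G] [BorelSpace G],
    IsCompactSimpleLieGroup G → ∀ r : LatticeRep G, ∃ K a₂ κ₂ : ℝ, 0 < K ∧ 0 < a₂ ∧ 0 < κ₂ ∧
      ∀ ε a κ : ℝ, 0 < ε → 4 * ε ≤ a → a ≤ a₂ → 0 < κ → κ ≤ κ₂ → ∃ β₀ : ℝ,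
        ∀ β : ℝ, β₀ ≤ β → ∀ ζ : LGConfig 4 G,
          CrudeGoodG r.ρ β (κ / 2) ⌈β ^ a⌉₊ ζ →
          boxKernelG r.ρ β ⌈β ^ a⌉₊ ζ (coldEvent r β (2 * κ) (AxialGauge.boxEdges 4 (2 * ⌈β ^ a⌉₊ + 1)))ᶜ ≤
            ENNReal.ofReal (Real.exp (-(β ^ (κ / 8)))) →
          |(∫ U, softLoopObs r ⌈β ^ ε⌉₊ (configShift (-(boxCentre ⌈β ^ a⌉₊)) (timeShiftLG (G := G) ⌈β ^ ε⌉₊ U))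
                ∂(boxKernelG r.ρ β ⌈β ^ a⌉₊ ζ)) -
              ∫ U, softLoopObs r ⌈β ^ ε⌉₊ (configShift (-(boxCentre ⌈β ^ a⌉₊)) U) ∂(boxKernelG r.ρ β ⌈β ^ a⌉₊ ζ)| ≤
            K * (⌈β ^ ε⌉₊ : ℝ) ^ 8 * β ^ (κ - 1) / (⌈β ^ a⌉₊ : ℝ) := by
  sorry

/-- **K1r `stub_dlrTransferG_of_goodFloor_of_smoothRate`** (ym-line-sll-p3; = the landed K1⁺⁺ `dlrTransferG_of_goodFloor_of_smooth` with the smoothness RATE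
abstracted to any `ρ` with `ρ(β)² = o(R³β^{-2})` and the smoothness antecedent in T′'s exponential-typicality form): box floor ∧ outer mean smoothness ⇒
eventually in the torus side `(c/8)·R³β^{-2} ≤ torusLagCov`. -/
theorem stub_dlrTransferG_of_goodFloor_of_smoothRate :
    ∀ (G : Type) [Group G] [TopologicalSpace G] [IsTopologicalGroup G] [CompactSpace G] [MeasurableSpace G] [BorelSpace G]
      (r : LatticeRep G) (ε a κ c : ℝ) (ρ : ℝ → ℝ), 0 < ε → 0 < κ → κ < 1 → 0 < c → 13 * ε + κ < 2 * a →
      (∀ θ : ℝ, 0 < θ → ∃ β₀ : ℝ, ∀ β : ℝ, β₀ ≤ β → ρ β ^ 2 ≤ θ * (⌈β ^ ε⌉₊ : ℝ) ^ 3 * β ^ (-(2 : ℝ))) →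
      (∃ β₀ : ℝ, ∀ β : ℝ, β₀ ≤ β → ∀ η : LGConfig 4 G,
          (∀ p ∈ plaquettesTouching (lagBox ⌈β ^ a⌉₊),
            (r.N : ℝ) - plaquetteObs r.ρ p.1 p.2.1.1 p.2.1.2 η ≤ β ^ (κ / 2 - 1)) →
          ymSpecification (d := 4) r.ρ β (lagBox ⌈β ^ a⌉₊) η (coldEvent r β κ (lagBox ⌈β ^ a⌉₊))ᶜ ≤
            ENNReal.ofReal (Real.exp (-(β ^ (κ / 4)))) →
          c * (⌈β ^ ε⌉₊ : ℝ) ^ 3 * β ^ (-(2 : ℝ)) ≤ lagCov (coldKernel r β κ ⌈β ^ a⌉₊ η) (softLoopObs r ⌈β ^ ε⌉₊) ⌈β ^ ε⌉₊) →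
      (∃ β₀ : ℝ, ∀ β : ℝ, β₀ ≤ β → ∀ η : LGConfig 4 G,
          (∀ p ∈ plaquettesTouching (lagBox ⌈β ^ a⌉₊),
            (r.N : ℝ) - plaquetteObs r.ρ p.1 p.2.1.1 p.2.1.2 η ≤ β ^ (κ / 2 - 1)) →
          ymSpecification (d := 4) r.ρ β (lagBox ⌈β ^ a⌉₊) η (coldEvent r β κ (lagBox ⌈β ^ a⌉₊))ᶜ ≤
            ENNReal.ofReal (Real.exp (-(β ^ (κ / 4)))) →
          |condMean r β κ ⌈β ^ a⌉₊ (fun U => softLoopObs r ⌈β ^ ε⌉₊ (timeShiftLG (G := G) ⌈β ^ ε⌉₊ U)) η -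
              condMean r β κ ⌈β ^ a⌉₊ (softLoopObs r ⌈β ^ ε⌉₊) η| ≤ ρ β) →
      ∃ β₀ : ℝ, ∀ β : ℝ, β₀ ≤ β → ∀ᶠ L : ℕ in atTop,
        c / 8 * (⌈β ^ ε⌉₊ : ℝ) ^ 3 * β ^ (-(2 : ℝ)) ≤ torusLagCov r β L (softLoopObs r ⌈β ^ ε⌉₊) ⌈β ^ ε⌉₊ := by
  sorry

/-- **K5 `stub_limitPassageG` — CLOSED** (lead, p585234, `Theorems/SoftLoopLongLagSoftLoopLagFloorToTorusStubLimitPassageG.lean`): the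
landed tree theorem BY NAME.  An eventual torus floor at fixed `β` passes to every torus-limit state as an `rpCorr` floor, with the trivial
ceiling at lag `0`. -/
theorem stub_limitPassageG :
    ∀ (G : Type) [Group G] [TopologicalSpace G] [IsTopologicalGroup G] [CompactSpace G] [MeasurableSpace G] [BorelSpace G]
      (r : LatticeRep G) (β θ : ℝ) (R : ℕ),
      (∀ᶠ L : ℕ in atTop, θ ≤ torusLagCov r β L (softLoopObs r R) R) →
      ∀ μ ∈ infiniteVolumeLimitPoints (d := 4) r.ρ β,
        θ ≤ rpCorr μ (softLoopObs r R) R ∧ rpCorr μ (softLoopObs r R) 0 ≤ ((2 * R + 1 : ℕ) : ℝ) ^ 8 :=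
  Summit.QuantumFields.YangMills.Theorems.SoftLoopLongLag.stub_limitPassageG

/-! ## Composition (kernel-checked): hT (T′ rev 3 = stmt-QuantumFields-24180) ∧ E2 ∧ P_K ∧ K1r ∧ K5 (landed) ⇒ K′ BY NAME -/

/-- The smoothness rate delivered by the mean mixture is `o(R³β^{-2})`: for `κ ≤ ε`, `(A·R⁸·β^{κ−1}/⌈β^{31ε/4}⌉)² ≤ θ·R³·β^{-2}` eventually, every `θ > 0`, any constant `A`
(`R ≤ 2β^ε`, `R¹³ ≤ 2¹³β^{13ε}`, `β^{2κ−2} ≤ β^{2ε}β^{-2}`, `⌈β^{31ε/4}⌉² ≥ β^{31ε/2}`, and `2¹³A²/θ ≤ β^{ε/2}` eventually). -/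
theorem eventually_rate_sq_le {ε κ A θ : ℝ} (hε : 0 < ε) (hκε : κ ≤ ε) (hθ : 0 < θ) :
    ∃ β₀ : ℝ, ∀ β : ℝ, β₀ ≤ β →
      (A * (⌈β ^ ε⌉₊ : ℝ) ^ 8 * β ^ (κ - 1) / (⌈β ^ (31 / 4 * ε)⌉₊ : ℝ)) ^ 2 ≤
        θ * (⌈β ^ ε⌉₊ : ℝ) ^ 3 * β ^ (-(2 : ℝ)) := by
  have hε2 : 0 < ε / 2 := by positivity
  obtain ⟨β₀, hβ₀⟩ := eventually_atTop.1 (((tendsto_rpow_atTop hε2).eventually_ge_atTop (2 ^ 13 * A ^ 2 / θ)).and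
    (eventually_ge_atTop (1 : ℝ)))
  refine ⟨β₀, fun β hβ => ?_⟩
  obtain ⟨hkey, hβ1⟩ := hβ₀ β hβ
  have hβ0 : 0 < β := one_pos.trans_le hβ1
  set R : ℕ := ⌈β ^ ε⌉₊ with hRdef
  set H : ℕ := ⌈β ^ (31 / 4 * ε)⌉₊ with hHdef
  have hβε1 : (1 : ℝ) ≤ β ^ ε := Real.one_le_rpow hβ1 hε.le
  have hR1 : (1 : ℝ) ≤ (R : ℝ) := hβε1.trans (Nat.le_ceil _)
  have hR0 : (0 : ℝ) ≤ (R : ℝ) := zero_le_one.trans hR1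
  have hRle : (R : ℝ) ≤ 2 * β ^ ε := by
    have := (Nat.ceil_lt_add_one (zero_le_one.trans hβε1)).le
    rw [hRdef]; linarith
  have hHge : β ^ (31 / 4 * ε) ≤ (H : ℝ) := Nat.le_ceil _
  have hH0 : (0 : ℝ) < (H : ℝ) := lt_of_lt_of_le (Real.rpow_pos_of_pos hβ0 _) hHge
  -- the pieces
  have hR13 : (R : ℝ) ^ 13 ≤ 2 ^ 13 * β ^ (13 * ε) := by
    have h := pow_le_pow_left₀ hR0 hRle 13
    have e : (β ^ ε) ^ 13 = β ^ (13 * ε) := by rw [← Real.rpow_natCast, ← Real.rpow_mul hβ0.le]; ring_nf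
    calc (R : ℝ) ^ 13 ≤ (2 * β ^ ε) ^ 13 := h
      _ = 2 ^ 13 * (β ^ ε) ^ 13 := by ring
      _ = 2 ^ 13 * β ^ (13 * ε) := by rw [e]
  have hβκ2 : (β ^ (κ - 1)) ^ 2 ≤ β ^ (2 * ε) * β ^ (-(2 : ℝ)) := by
    have h1 : β ^ (κ - 1) ≤ β ^ (ε - 1) := Real.rpow_le_rpow_of_exponent_le hβ1 (by linarith)
    have h2 := pow_le_pow_left₀ (Real.rpow_nonneg hβ0.le _) h1 2
    have e : (β ^ (ε - 1)) ^ 2 = β ^ (2 * ε) * β ^ (-(2 : ℝ)) := by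
      rw [← Real.rpow_natCast, ← Real.rpow_mul hβ0.le, ← Real.rpow_add hβ0]; ring_nf
    rwa [e] at h2
  have hH2 : β ^ (31 / 2 * ε) ≤ (H : ℝ) ^ 2 := by
    have h := pow_le_pow_left₀ (Real.rpow_nonneg hβ0.le _) hHge 2
    have e : (β ^ (31 / 4 * ε)) ^ 2 = β ^ (31 / 2 * ε) := by rw [← Real.rpow_natCast, ← Real.rpow_mul hβ0.le]; ring_nf
    rwa [e] at h
  have hsplit : β ^ (ε / 2) * (β ^ (13 * ε) * β ^ (2 * ε)) = β ^ (31 / 2 * ε) := by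
    rw [← Real.rpow_add hβ0, ← Real.rpow_add hβ0]; ring_nf
  have hkey' : 2 ^ 13 * A ^ 2 ≤ θ * β ^ (ε / 2) := by
    have := (div_le_iff₀ hθ).1 hkey
    linarith
  -- assemble
  rw [div_pow, div_le_iff₀ (pow_pos hH0 2)]
  calc (A * (R : ℝ) ^ 8 * β ^ (κ - 1)) ^ 2 = A ^ 2 * ((R : ℝ) ^ 13 * (β ^ (κ - 1)) ^ 2) * (R : ℝ) ^ 3 := by ring
    _ ≤ A ^ 2 * ((2 ^ 13 * β ^ (13 * ε)) * (β ^ (2 * ε) * β ^ (-(2 : ℝ)))) * (R : ℝ) ^ 3 := by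
        have := mul_le_mul hR13 hβκ2 (by positivity) (by positivity)
        have hK2 : (0 : ℝ) ≤ A ^ 2 := by positivity
        exact mul_le_mul_of_nonneg_right (mul_le_mul_of_nonneg_left this hK2) (by positivity)
    _ = (2 ^ 13 * A ^ 2) * (β ^ (13 * ε) * β ^ (2 * ε)) * ((R : ℝ) ^ 3 * β ^ (-(2 : ℝ))) := by ring
    _ ≤ (θ * β ^ (ε / 2)) * (β ^ (13 * ε) * β ^ (2 * ε)) * ((R : ℝ) ^ 3 * β ^ (-(2 : ℝ))) :=
        mul_le_mul_of_nonneg_right (mul_le_mul_of_nonneg_right hkey' (by positivity)) (by positivity)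
    _ = θ * (R : ℝ) ^ 3 * β ^ (-(2 : ℝ)) * (β ^ (ε / 2) * (β ^ (13 * ε) * β ^ (2 * ε))) := by ring
    _ = θ * (R : ℝ) ^ 3 * β ^ (-(2 : ℝ)) * β ^ (31 / 2 * ε) := by rw [hsplit]
    _ ≤ θ * (R : ℝ) ^ 3 * β ^ (-(2 : ℝ)) * (H : ℝ) ^ 2 := mul_le_mul_of_nonneg_left hH2 (by positivity)

/-- X in the LINE'S VOCABULARY from hT (rev 3): `ε := min (min ε₀ κ₂) (4a₂/31)`, `κ` from T′ (`κ ≤ ε ≤ κ₂`), inner exponent `31ε/4`, smoothness by E2 + P_K,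
transfer by K1r with `ρ β := 2K·R⁸·β^{κ−1}/⌈β^{31ε/4}⌉`, passage by the landed K5; `q := 3 + 8ε`. -/
theorem torusFloor_lineForm (hT : Summit.QuantumFields.YangMills.Theses.SoftLoopLongLag.ColdBoxSoftLoopLagFloor) :
    ∀ (G : Type) [Group G] [TopologicalSpace G] [IsTopologicalGroup G] [CompactSpace G] [MeasurableSpace G] [BorelSpace G],
    IsCompactSimpleLieGroup G → ∀ r : LatticeRep G, ∃ ε q β₀ : ℝ, 0 < ε ∧ 0 < q ∧
      ∀ β : ℝ, β₀ ≤ β → ∀ μ ∈ infiniteVolumeLimitPoints (d := 4) r.ρ β,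
        β ^ (-q) ≤ rpCorr μ (softLoopObs r ⌈β ^ ε⌉₊) ⌈β ^ ε⌉₊ ∧ rpCorr μ (softLoopObs r ⌈β ^ ε⌉₊) 0 ≤ β ^ q := by
  intro G _ _ _ _ _ _ hG r
  obtain ⟨c, ε₀, hc, hε₀, hTr⟩ := hT G hG r
  obtain ⟨K, a₂, κ₂, _hK, ha₂, hκ₂, hE2⟩ := stub_innerDatumMeanSmoothG G hG r
  -- exponents
  set ε : ℝ := min (min ε₀ κ₂) (4 * a₂ / 31) with hεdef
  have hε : 0 < ε := lt_min (lt_min hε₀ hκ₂) (by positivity)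
  have hεle : ε ≤ ε₀ := (min_le_left _ _).trans (min_le_left _ _)
  have hεκ₂ : ε ≤ κ₂ := (min_le_left _ _).trans (min_le_right _ _)
  have ha4 : 4 * ε ≤ 31 / 4 * ε := by linarith
  have ha₂' : 31 / 4 * ε ≤ a₂ := by have := min_le_right (min ε₀ κ₂) (4 * a₂ / 31); rw [hεdef]; linarith
  obtain ⟨κ, β₄, hκ, hκε, hκ1, hfloor⟩ := hTr ε hε hεle
  have hwin : 13 * ε + κ < 2 * (8 * ε) := by linarith
  obtain ⟨β₂, hsmoothIn⟩ := hE2 ε (31 / 4 * ε) κ hε ha4 ha₂' hκ (hκε.trans hεκ₂)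
  have hb : (0 : ℝ) < 31 / 4 * ε := by positivity
  have hba : 31 / 4 * ε < 8 * ε := by linarith
  obtain ⟨β₃, hsmooth⟩ := condMeanSmooth_of_innerMixture G r ε (31 / 4 * ε) (8 * ε) κ K hε hκ hb hba
    ⟨β₂, fun β hβ ζ hgood htyp => hsmoothIn β hβ ζ hgood htyp⟩
  obtain ⟨β₁, htorus⟩ := stub_dlrTransferG_of_goodFloor_of_smoothRate G r ε (8 * ε) κ c
    (fun β => (2 * |K| + 1) * (⌈β ^ ε⌉₊ : ℝ) ^ 8 * β ^ (κ - 1) / (⌈β ^ (31 / 4 * ε)⌉₊ : ℝ)) hε hκ hκ1 hc hwin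
    (fun θ hθ => eventually_rate_sq_le (A := 2 * |K| + 1) hε hκε hθ)
    ⟨β₄, fun β hβ η hgood htyp => hfloor β hβ η hgood htyp⟩ ⟨β₃, fun β hβ η _hgood htyp => hsmooth β hβ η htyp⟩
  -- final exponent `q := 3 + 8ε` and thresholds
  set q : ℝ := 3 + 8 * ε with hqdef
  have hq : 0 < q := by positivity
  have hT1 : ∀ᶠ β : ℝ in atTop, β ^ (-q) ≤ c / 8 * (⌈β ^ ε⌉₊ : ℝ) ^ 3 * β ^ (-(2 : ℝ)) := by
    have hlim : Tendsto (fun β : ℝ => β ^ (-(1 + 8 * ε))) atTop (𝓝 0) :=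
      tendsto_rpow_neg_atTop (by positivity)
    filter_upwards [hlim.eventually (eventually_le_nhds (show (0 : ℝ) < c / 8 by positivity)),
      eventually_ge_atTop (1 : ℝ)] with β hβ hβ1
    have hβ0 : 0 < β := one_pos.trans_le hβ1
    have hR1 : (1 : ℝ) ≤ (⌈β ^ ε⌉₊ : ℝ) := (Real.one_le_rpow hβ1 hε.le).trans (Nat.le_ceil _)
    have hR3 : (1 : ℝ) ≤ (⌈β ^ ε⌉₊ : ℝ) ^ 3 := one_le_pow₀ hR1
    have hsplit : β ^ (-q) = β ^ (-(1 + 8 * ε)) * β ^ (-(2 : ℝ)) := by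
      rw [← Real.rpow_add hβ0]; congr 1; rw [hqdef]; ring
    rw [hsplit]
    have hβ2 : 0 ≤ β ^ (-(2 : ℝ)) := Real.rpow_nonneg hβ0.le _
    calc β ^ (-(1 + 8 * ε)) * β ^ (-(2 : ℝ)) ≤ c / 8 * β ^ (-(2 : ℝ)) := mul_le_mul_of_nonneg_right hβ hβ2
      _ = c / 8 * 1 * β ^ (-(2 : ℝ)) := by ring
      _ ≤ c / 8 * (⌈β ^ ε⌉₊ : ℝ) ^ 3 * β ^ (-(2 : ℝ)) :=
          mul_le_mul_of_nonneg_right (mul_le_mul_of_nonneg_left hR3 (by positivity)) hβ2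
  have hT2 : ∀ᶠ β : ℝ in atTop, (((2 * ⌈β ^ ε⌉₊ + 1 : ℕ) : ℝ)) ^ 8 ≤ β ^ q := by
    filter_upwards [eventually_ge_atTop (1 : ℝ), (tendsto_rpow_atTop (show (0 : ℝ) < 3 by norm_num)).eventually_ge_atTop
      ((3 : ℝ) ^ 8), (tendsto_rpow_atTop hε).eventually_ge_atTop (3 : ℝ)] with β hβ1 hβ3 hβε3
    have hβ0 : 0 < β := one_pos.trans_le hβ1
    have hβε : 1 ≤ β ^ ε := Real.one_le_rpow hβ1 hε.le
    have hceil : (⌈β ^ ε⌉₊ : ℝ) ≤ β ^ ε + 1 := (Nat.ceil_lt_add_one (zero_le_one.trans hβε)).le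
    have hbase : (((2 * ⌈β ^ ε⌉₊ + 1 : ℕ) : ℝ)) ≤ 3 * β ^ ε := by push_cast; linarith
    have hpow : (((2 * ⌈β ^ ε⌉₊ + 1 : ℕ) : ℝ)) ^ 8 ≤ (3 * β ^ ε) ^ 8 :=
      pow_le_pow_left₀ (by positivity) hbase 8
    have hsplit : β ^ q = β ^ (3 : ℝ) * (β ^ ε) ^ 8 := by
      rw [hqdef, Real.rpow_add hβ0, show (8 : ℝ) * ε = ε * (8 : ℕ) by push_cast; ring, Real.rpow_mul_natCast hβ0.le]
    rw [hsplit]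
    calc (((2 * ⌈β ^ ε⌉₊ + 1 : ℕ) : ℝ)) ^ 8 ≤ (3 * β ^ ε) ^ 8 := hpow
      _ = 3 ^ 8 * (β ^ ε) ^ 8 := by ring
      _ ≤ β ^ (3 : ℝ) * (β ^ ε) ^ 8 := mul_le_mul_of_nonneg_right hβ3 (by positivity)
  obtain ⟨β₅, hβ₅⟩ := eventually_atTop.1 (hT1.and hT2)
  refine ⟨ε, q, max β₁ β₅, hε, hq, fun β hβ μ hμ => ?_⟩
  obtain ⟨hlow, hhigh⟩ := hβ₅ β ((le_max_right _ _).trans hβ)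
  have hev := htorus β ((le_max_left _ _).trans hβ)
  obtain ⟨hfl, hce⟩ := stub_limitPassageG G r β _ ⌈β ^ ε⌉₊ hev μ hμ
  exact ⟨hlow.trans hfl, hce.trans hhigh⟩

/-- **The crux K′ BY NAME.**  `T′ → X` with the re-typed `T′` (rev 3) USED. -/
theorem SoftLoopLagFloorToTorus_of_stubs :
    Summit.QuantumFields.YangMills.Theses.SoftLoopLongLag.SoftLoopLagFloorToTorus := by
  intro hT G _ _ _ _ _ _ hG r
  obtain ⟨ε, q, β₀, hε, hq, h⟩ := torusFloor_lineForm hT G hG r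
  exact ⟨ε, q, β₀, hε, hq, fun β hβ μ hμ => h β hβ μ hμ⟩

end Summit.QuantumFields.YangMills.Cruxes.SoftLoopLagFloorToTorus.Birth

end
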